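import Literature.NumberTheory.Weil1964.AdelicMetaplecticProductContinuity
import Literature.NumberTheory.GelbartRogawski1991.DoubledUnitarySiegelParabolicAlgebra
import HarnessLib

-- buildfix G11b-3 recipe (LEDGER B13-1/B13-3): elaborate sequentially so the trailing `attribute [implicit_reducible]`
-- block (reducibilityCoreExt is keyed to the async environment branch) is in force at `.olean` export.
set_option Elab.async false

/-!
# The doubled Weil representation assembled from its finite and archimedean halves

[GelbartRogawski1991, §3.1 Prop. 3.1.1] by doubling: given a FINITE half `sf` (`IsFinHalf χ sf`, operators `1 ⊗ B`)
and an ARCHIMEDEAN half `sa` (`IsArchHalf χ sa`, operators `A ⊗ 1`) of `DoubledUnitaryGlobalSplittingData`, the map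
`sD(g) := sa(g_∞) · sf(g_f)` (`assemble`; `H(𝔸) = H(L⁺ ⊗ ℝ) × H(𝔸_f)`, tree `UnitaryGroup.adelicProdEquiv ∕ archPart ∕
finPart`, Mathlib `MonoidHom.noncommCoprod`) is a homomorphism because the halves COMMUTE (their symplectic parts
commute and `A ⊗ 1`, `1 ⊗ B` commute; joint injectivity of `(π, ω)`), lies over `ι^𝔻` (`proj_assemble`), is
continuous (`S1asm_continuous`, tree `Weil1964.continuous_mul_hom_of_arch_fin`) and satisfies the parabolic
prescription on `P_Δ(𝔸)` (`S1asm_parabolic`: `P_Δ(𝔸)` is closed under the place decomposition `p = p_∞ · p_f`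
(`S1par_components`), `det_Δ`, `χ(det_Δ)`, `|det_Δ|^{1/2}` are multiplicative, and `(ω(XY)Φ)(0)` factorises).
End theorem: `isDoubledWeilRep_assemble : IsFinHalf χ sf → IsArchHalf χ sa → IsDoubledWeilRep χ (assemble …)`.
-/

set_option autoImplicit false

noncomputable section

open scoped Classical
open scoped Matrix Kronecker TensorProduct
open NumberField IsDedekindDomain
open Literature.RepresentationTheory.HeisenbergGroup
open Literature.NumberTheory.Automorphic
open Literature.NumberTheory.Weil1964
open Literature.RepresentationTheory.HarrisKudlaSweet1996
open Literature.NumberTheory.GaloisRepresentations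

namespace Literature.NumberTheory.GelbartRogawski1991.GRConstruction

open UnitaryDualPair

variable (L : Type) [Field L] [NumberField L] [IsCMField L]

variable {N M n : ℕ} (e : Fin N × Fin M ≃ Fin n)
  (dV : Fin N → L) (hdV : ∀ i, IsCMField.complexConj L (dV i) = dV i) (hdV0 : ∀ i, dV i ≠ 0)
  (dW : Fin M → L) (hdW : ∀ i, IsCMField.complexConj L (dW i) = dW i) (hdW0 : ∀ i, dW i ≠ 0)

section Assembly

variable {χ : HeckeCharacter L}
  {sf : UnitaryGroup.finAdelic (Fp L) L (IsCMField.complexConj L) (n + n) (hermD L e dV hdV dW hdW) →* MpD L e dV hdV dW hdW}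
  {sa : UnitaryGroup.arch (Fp L) L (IsCMField.complexConj L) (n + n) (hermD L e dV hdV dW hdW) →* MpD L e dV hdV dW hdW}

/-- ABSTRACT: with `(π, op)` jointly injective, two elements commute as soon as their `π`- and `op`-images commute.
[cite: HarrisKudlaSweet1996, §1 (1.11)–(1.16)] -/
theorem commute_abstract {M S O : Type*} [Group M] [Group S] [Monoid O] (π : M →* S) (op : M →* O)
    (hinj : ∀ x y : M, π x = π y → op x = op y → x = y) (x y : M)
    (hπ : Commute (π x) (π y)) (hop : Commute (op x) (op y)) : Commute x y :=
  hinj _ _ (by rw [map_mul, map_mul]; exact hπ.eq) (by rw [map_mul, map_mul]; exact hop.eq)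

include hdV0 hdW0 in
set_option maxHeartbeats 4000000 in
/-- the archimedean and finite halves COMMUTE in `Mp(𝕎^𝔻)ᶜᵒⁿᵗ`: their symplectic parts commute (`(g_∞, 1)` and `(1, g_f)`
commute in `H(𝔸)`, tree `commute_archToAdelic_finAdelicToAdelic`) and their operators `A ⊗ 1`, `1 ⊗ B` commute; conclude by
the joint injectivity of `(π, op)`. [cite: HarrisKudlaSweet1996, §1 (1.11)–(1.16)] -/
theorem commute_halves (hf : IsFinHalf L e dV hdV hdV0 dW hdW hdW0 χ sf) (ha : IsArchHalf L e dV hdV hdV0 dW hdW hdW0 χ sa)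
    (a : UnitaryGroup.arch (Fp L) L (IsCMField.complexConj L) (n + n) (hermD L e dV hdV dW hdW))
    (b : UnitaryGroup.finAdelic (Fp L) L (IsCMField.complexConj L) (n + n) (hermD L e dV hdV dW hdW)) :
    Commute (sa a) (sf b) :=
  (ha.isArch a).elim fun A hA => (hf.isFinite b).elim fun B hB =>
    commute_abstract (projD L e dV hdV dW hdW) (adelicMpCont.omega (Fp L) (Fin (n + n)) (gramDA L e dV hdV dW hdW))
      (eq_of_proj_eq_of_omega_eq L e dV hdV dW hdW) _ _
      (by
        have hpa := ha.proj_eq a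
        have hpb := hf.proj_eq b
        rw [hpa, hpb]
        exact (UnitaryGroup.commute_archToAdelic_finAdelicToAdelic (Fp L) L (IsCMField.complexConj L) (n + n)
          (hermD L e dV hdV dW hdW) a b).map _)
      (by
        have h := adelicTensorEnd_left_right_comm L (A : _ →ₗ[ℂ] _) B
        rw [← hA, ← hB] at h
        exact h)

/-- the assembled map `sD(g) := sa(g_∞) · sf(g_f)` (tree `adelicProdEquiv`, Mathlib `MonoidHom.noncommCoprod`).
[cite: HarrisKudlaSweet1996, §1 (1.11)–(1.16)] -/
def assemble (hf : IsFinHalf L e dV hdV hdV0 dW hdW hdW0 χ sf) (ha : IsArchHalf L e dV hdV hdV0 dW hdW hdW0 χ sa) :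
    HA L e dV hdV dW hdW →* MpD L e dV hdV dW hdW :=
  (MonoidHom.noncommCoprod sa sf (commute_halves L e dV hdV hdV0 dW hdW hdW0 hf ha)).comp
    (MonoidHom.prod (UnitaryGroup.archPart (Fp L) L (IsCMField.complexConj L) (n + n) (hermD L e dV hdV dW hdW))
      (UnitaryGroup.finPart (Fp L) L (IsCMField.complexConj L) (n + n) (hermD L e dV hdV dW hdW)))

include hdV0 hdW0 in
set_option maxHeartbeats 1600000 in
/-- `assemble` lies over `ι^𝔻`. [cite: HarrisKudlaSweet1996, §1 (1.11)–(1.16)] -/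
theorem proj_assemble (hf : IsFinHalf L e dV hdV hdV0 dW hdW hdW0 χ sf) (ha : IsArchHalf L e dV hdV hdV0 dW hdW hdW0 χ sa)
    (g : HA L e dV hdV dW hdW) :
    projD L e dV hdV dW hdW (assemble L e dV hdV hdV0 dW hdW hdW0 hf ha g) = toSpD L e dV hdV dW hdW g := by
  have h1 : assemble L e dV hdV hdV0 dW hdW hdW0 hf ha g =
      sa (UnitaryGroup.archPart (Fp L) L (IsCMField.complexConj L) (n + n) (hermD L e dV hdV dW hdW) g) *
        sf (UnitaryGroup.finPart (Fp L) L (IsCMField.complexConj L) (n + n) (hermD L e dV hdV dW hdW) g) := by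
    unfold assemble
    rfl
  have h2 := UnitaryGroup.archToAdelic_mul_finAdelicToAdelic (Fp L) L (IsCMField.complexConj L) (n + n)
    (hermD L e dV hdV dW hdW) g
  have hpa := ha.proj_eq (UnitaryGroup.archPart (Fp L) L (IsCMField.complexConj L) (n + n) (hermD L e dV hdV dW hdW) g)
  have hpb := hf.proj_eq (UnitaryGroup.finPart (Fp L) L (IsCMField.complexConj L) (n + n) (hermD L e dV hdV dW hdW) g)
  have h3 := (toSpD L e dV hdV dW hdW).map_mul
    (UnitaryGroup.archToAdelic (Fp L) L (IsCMField.complexConj L) (n + n) (hermD L e dV hdV dW hdW)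
      (UnitaryGroup.archPart (Fp L) L (IsCMField.complexConj L) (n + n) (hermD L e dV hdV dW hdW) g))
    (UnitaryGroup.finAdelicToAdelic (Fp L) L (IsCMField.complexConj L) (n + n) (hermD L e dV hdV dW hdW)
      (UnitaryGroup.finPart (Fp L) L (IsCMField.complexConj L) (n + n) (hermD L e dV hdV dW hdW) g))
  exact (congrArg (projD L e dV hdV dW hdW) h1).trans <|
    ((projD L e dV hdV dW hdW).map_mul _ _).trans <|
      (congrArg₂ (· * ·) hpa hpb).trans <| h3.symm.trans (congrArg _ h2)

include hdV0 hdW0 in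
/-- **S1asm-cont** (on the tree's generic lemma `Literature.NumberTheory.Weil1964.continuous_mul_hom_of_arch_fin`,
`Weil1964/AdelicMetaplecticProductContinuity.lean`):
`g ↦ sa(g_∞) sf(g_f)` is continuous for the weak topology of `Mp(𝕎^𝔻)ᶜᵒⁿᵗ`.
[cite: HarrisKudlaSweet1996, §1 (1.11)–(1.16)] -/
theorem S1asm_continuous (hf : IsFinHalf L e dV hdV hdV0 dW hdW hdW0 χ sf) (ha : IsArchHalf L e dV hdV hdV0 dW hdW hdW0 χ sa) :
    Continuous (assemble L e dV hdV hdV0 dW hdW hdW0 hf ha) := by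
  have h : ⇑(assemble L e dV hdV hdV0 dW hdW hdW0 hf ha) = fun g =>
      sa (UnitaryGroup.archPart (Fp L) L (IsCMField.complexConj L) (n + n) (hermD L e dV hdV dW hdW) g) *
        sf (UnitaryGroup.finPart (Fp L) L (IsCMField.complexConj L) (n + n) (hermD L e dV hdV dW hdW) g) := by
    funext g; unfold assemble; rfl
  rw [h]
  exact Literature.NumberTheory.Weil1964.continuous_mul_hom_of_arch_fin ha.continuous hf.continuous ha.isArch hf.isFinite
    (UnitaryGroup.continuous_archPart (Fp L) L (IsCMField.complexConj L) (n + n) (hermD L e dV hdV dW hdW))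
    (UnitaryGroup.continuous_finPart (Fp L) L (IsCMField.complexConj L) (n + n) (hermD L e dV hdV dW hdW))

/-! ## The parabolic prescription of the assembled map -/

/-- **S1par-comp**: `p ∈ P_Δ(𝔸)` has both place components `(p_∞, 1)`, `(1, p_f)` in `P_Δ(𝔸)` (entrywise in
`𝔸_L = L_∞ × 𝔸_{L,f}`, tree `GLn.coe_ofInfinite_apply` ∕ `GLn.coe_ofFinite_apply`).
[cite: HarrisKudlaSweet1996, §1 (1.11)–(1.16)] -/
theorem S1par_components (p : HA L e dV hdV dW hdW) (hS : IsSiegelDelta L e dV hdV dW hdW p) :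
    IsSiegelDelta L e dV hdV dW hdW
        (UnitaryGroup.archToAdelic (Fp L) L (IsCMField.complexConj L) (n + n) (hermD L e dV hdV dW hdW)
          (UnitaryGroup.archPart (Fp L) L (IsCMField.complexConj L) (n + n) (hermD L e dV hdV dW hdW) p)) ∧
      IsSiegelDelta L e dV hdV dW hdW
        (UnitaryGroup.finAdelicToAdelic (Fp L) L (IsCMField.complexConj L) (n + n) (hermD L e dV hdV dW hdW)
          (UnitaryGroup.finPart (Fp L) L (IsCMField.complexConj L) (n + n) (hermD L e dV hdV dW hdW) p)) := by
  rw [isSiegelDelta_iff_entry] at hS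
  have hXa : ∀ a b : Fin (n + n),
      ((UnitaryGroup.archToAdelic (Fp L) L (IsCMField.complexConj L) (n + n) (hermD L e dV hdV dW hdW)
          (UnitaryGroup.archPart (Fp L) L (IsCMField.complexConj L) (n + n) (hermD L e dV hdV dW hdW) p)).1 :
          Matrix (Fin (n + n)) (Fin (n + n)) (AdeleRing (𝓞 L) L)) a b =
        ((((p : GL (Fin (n + n)) (AdeleRing (𝓞 L) L)) : Matrix _ _ (AdeleRing (𝓞 L) L)) a b).1,
          (1 : Matrix (Fin (n + n)) (Fin (n + n)) (FiniteAdeleRing (𝓞 L) L)) a b) := by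
    intro a b
    change (GLn.ofInfinite (n + n) L
      (UnitaryGroup.archPart (Fp L) L (IsCMField.complexConj L) (n + n) (hermD L e dV hdV dW hdW) p :
        GL (Fin (n + n)) (mixedEmbedding.mixedSpace L)) : Matrix _ _ (AdeleRing (𝓞 L) L)) a b = _
    rw [GLn.coe_ofInfinite_apply]
    refine Prod.ext ?_ rfl
    exact (InfiniteAdeleRing.ringEquiv_mixedSpace L).symm_apply_apply _
  have hXb : ∀ a b : Fin (n + n),
      ((UnitaryGroup.finAdelicToAdelic (Fp L) L (IsCMField.complexConj L) (n + n) (hermD L e dV hdV dW hdW)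
          (UnitaryGroup.finPart (Fp L) L (IsCMField.complexConj L) (n + n) (hermD L e dV hdV dW hdW) p)).1 :
          Matrix (Fin (n + n)) (Fin (n + n)) (AdeleRing (𝓞 L) L)) a b =
        ((1 : Matrix (Fin (n + n)) (Fin (n + n)) (InfiniteAdeleRing L)) a b,
          ((((p : GL (Fin (n + n)) (AdeleRing (𝓞 L) L)) : Matrix _ _ (AdeleRing (𝓞 L) L)) a b).2)) := by
    intro a b
    change (GLn.ofFinite (n + n) L
      (UnitaryGroup.finPart (Fp L) L (IsCMField.complexConj L) (n + n) (hermD L e dV hdV dW hdW) p :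
        GL (Fin (n + n)) (FiniteAdeleRing (𝓞 L) L)) : Matrix _ _ (AdeleRing (𝓞 L) L)) a b = _
    rw [GLn.coe_ofFinite_apply]
    rfl
  constructor
  · rw [isSiegelDelta_iff_entry]
    intro i j
    rw [hXa, hXa, hXa, hXa]
    exact Prod.ext (congrArg Prod.fst (hS i j) :) (one_apply_siegel (R := FiniteAdeleRing (𝓞 L) L) i j :)
  · rw [isSiegelDelta_iff_entry]
    intro i j
    rw [hXb, hXb, hXb, hXb]
    exact Prod.ext (one_apply_siegel (R := InfiniteAdeleRing L) i j :) (congrArg Prod.snd (hS i j) :)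

include hdV0 hdW0 in
set_option maxHeartbeats 1600000 in
/-- **S1asm-par** (with S1par-comp): the parabolic prescription of `assemble` on `P_Δ(𝔸)` from the two
prescriptions on `P_Δ(∞)`, `P_Δ(𝔸_f)`: `p = p_∞ p_f` with both factors in `P_Δ`, `det_Δ`, `χ(det_Δ)` and `|det_Δ|^{1/2}`
multiplicative on `P_Δ(𝔸)` (`detDelta_mul`, `chiDet_mul`, `modDelta_mul` — block-triangularity in the basis adapted to `Δ`),
and `(ω(X_∞ X_f)Φ)(0) = c_∞ c_f Φ(0)` for the `δ`-conjugates (`opD_mul`).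
[cite: HarrisKudlaSweet1996, §1 (1.11)–(1.16)] -/
theorem S1asm_parabolic (hf : IsFinHalf L e dV hdV hdV0 dW hdW hdW0 χ sf) (ha : IsArchHalf L e dV hdV hdV0 dW hdW hdW0 χ sa) :
    ∀ (p : HA L e dV hdV dW hdW), IsSiegelDelta L e dV hdV dW hdW p → IsUnit (detDelta L e dV hdV dW hdW p) →
      ∀ Φ : piSchwartzBruhat (Fp L) (Fin (n + n)),
        opD L e dV hdV dW hdW (rDelta L e dV hdV hdV0 dW hdW hdW0 * assemble L e dV hdV hdV0 dW hdW hdW0 hf ha p *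
            (rDelta L e dV hdV hdV0 dW hdW hdW0)⁻¹) Φ 0 =
          ((chiDet L e dV hdV dW hdW χ p : ℂˣ) : ℂ) * (modDelta L e dV hdV dW hdW p : ℂ) *
            (Φ : (Fin (n + n) → AdeleRing (𝓞 (Fp L)) (Fp L)) → ℂ) 0 := by
  intro p hS _ Φ
  obtain ⟨hSa, hSb⟩ := S1par_components L e dV hdV dW hdW p hS
  have hua := isUnit_detDelta_of_isSiegelDelta L e dV hdV dW hdW _ hSa
  have hub := isUnit_detDelta_of_isSiegelDelta L e dV hdV dW hdW _ hSb
  have hpa := ha.parabolic _ hSa hua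
  have hpb := hf.parabolic _ hSb hub
  have h1 : assemble L e dV hdV hdV0 dW hdW hdW0 hf ha p =
      sa (UnitaryGroup.archPart (Fp L) L (IsCMField.complexConj L) (n + n) (hermD L e dV hdV dW hdW) p) *
        sf (UnitaryGroup.finPart (Fp L) L (IsCMField.complexConj L) (n + n) (hermD L e dV hdV dW hdW) p) := by
    unfold assemble
    rfl
  have h2 := UnitaryGroup.archToAdelic_mul_finAdelicToAdelic (Fp L) L (IsCMField.complexConj L) (n + n)
    (hermD L e dV hdV dW hdW) p
  have hconj : rDelta L e dV hdV hdV0 dW hdW hdW0 * assemble L e dV hdV hdV0 dW hdW hdW0 hf ha p *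
      (rDelta L e dV hdV hdV0 dW hdW hdW0)⁻¹ =
      rDelta L e dV hdV hdV0 dW hdW hdW0 *
          sa (UnitaryGroup.archPart (Fp L) L (IsCMField.complexConj L) (n + n) (hermD L e dV hdV dW hdW) p) *
          (rDelta L e dV hdV hdV0 dW hdW hdW0)⁻¹ *
        (rDelta L e dV hdV hdV0 dW hdW hdW0 *
          sf (UnitaryGroup.finPart (Fp L) L (IsCMField.complexConj L) (n + n) (hermD L e dV hdV dW hdW) p) *
          (rDelta L e dV hdV hdV0 dW hdW hdW0)⁻¹) :=
    (congrArg (fun q => rDelta L e dV hdV hdV0 dW hdW hdW0 * q * (rDelta L e dV hdV hdV0 dW hdW hdW0)⁻¹) h1).trans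
      (map_mul (MulAut.conj (rDelta L e dV hdV hdV0 dW hdW hdW0)) _ _)
  -- re-spell the two prescriptions with the atoms of `h2` (codomain `(adelicGroupData …).Adelic`), so that `ring` sees
  -- syntactically identical atoms
  have hpa' : ∀ Ψ : piSchwartzBruhat (Fp L) (Fin (n + n)),
      opD L e dV hdV dW hdW (rDelta L e dV hdV hdV0 dW hdW hdW0 *
          sa (UnitaryGroup.archPart (Fp L) L (IsCMField.complexConj L) (n + n) (hermD L e dV hdV dW hdW) p) *
          (rDelta L e dV hdV hdV0 dW hdW hdW0)⁻¹) Ψ 0 =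
        ((chiDet L e dV hdV dW hdW χ
            (UnitaryGroup.archToAdelic (Fp L) L (IsCMField.complexConj L) (n + n) (hermD L e dV hdV dW hdW)
              (UnitaryGroup.archPart (Fp L) L (IsCMField.complexConj L) (n + n) (hermD L e dV hdV dW hdW) p)) : ℂˣ) : ℂ) *
          (modDelta L e dV hdV dW hdW
            (UnitaryGroup.archToAdelic (Fp L) L (IsCMField.complexConj L) (n + n) (hermD L e dV hdV dW hdW)
              (UnitaryGroup.archPart (Fp L) L (IsCMField.complexConj L) (n + n) (hermD L e dV hdV dW hdW) p)) : ℂ) *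
          (Ψ : (Fin (n + n) → AdeleRing (𝓞 (Fp L)) (Fp L)) → ℂ) 0 := hpa
  have hpb' : ∀ Ψ : piSchwartzBruhat (Fp L) (Fin (n + n)),
      opD L e dV hdV dW hdW (rDelta L e dV hdV hdV0 dW hdW hdW0 *
          sf (UnitaryGroup.finPart (Fp L) L (IsCMField.complexConj L) (n + n) (hermD L e dV hdV dW hdW) p) *
          (rDelta L e dV hdV hdV0 dW hdW hdW0)⁻¹) Ψ 0 =
        ((chiDet L e dV hdV dW hdW χ
            (UnitaryGroup.finAdelicToAdelic (Fp L) L (IsCMField.complexConj L) (n + n) (hermD L e dV hdV dW hdW)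
              (UnitaryGroup.finPart (Fp L) L (IsCMField.complexConj L) (n + n) (hermD L e dV hdV dW hdW) p)) : ℂˣ) : ℂ) *
          (modDelta L e dV hdV dW hdW
            (UnitaryGroup.finAdelicToAdelic (Fp L) L (IsCMField.complexConj L) (n + n) (hermD L e dV hdV dW hdW)
              (UnitaryGroup.finPart (Fp L) L (IsCMField.complexConj L) (n + n) (hermD L e dV hdV dW hdW) p)) : ℂ) *
          (Ψ : (Fin (n + n) → AdeleRing (𝓞 (Fp L)) (Fp L)) → ℂ) 0 := hpb
  have hL := (congrArg (fun q => opD L e dV hdV dW hdW q Φ 0) hconj).trans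
    ((congr_fun (opD_mul L e dV hdV dW hdW _ _ Φ) 0).trans ((hpa' _).trans (congrArg (_ * ·) (hpb' Φ))))
  have hχ := (congrArg (chiDet L e dV hdV dW hdW χ) h2.symm).trans (chiDet_mul L e dV hdV dW hdW χ hSa hSb)
  have hm := (congrArg (modDelta L e dV hdV dW hdW) h2.symm).trans (modDelta_mul L e dV hdV dW hdW hSa hSb)
  refine hL.trans ?_
  rw [hχ, hm, Units.val_mul, Complex.ofReal_mul]
  ring

include hdV0 hdW0 in
/-- **S1asm — the doubled Weil representation assembled** from `commute_halves`, `proj_assemble`, `S1asm_parabolic` and `S1asm_continuous`.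
[cite: HarrisKudlaSweet1996, §1 (1.11)–(1.16)] -/
theorem isDoubledWeilRep_of_halves (χ : HeckeCharacter L)
    {sf : UnitaryGroup.finAdelic (Fp L) L (IsCMField.complexConj L) (n + n) (hermD L e dV hdV dW hdW) →* MpD L e dV hdV dW hdW}
    {sa : UnitaryGroup.arch (Fp L) L (IsCMField.complexConj L) (n + n) (hermD L e dV hdV dW hdW) →* MpD L e dV hdV dW hdW}
    (hf : IsFinHalf L e dV hdV hdV0 dW hdW hdW0 χ sf) (ha : IsArchHalf L e dV hdV hdV0 dW hdW hdW0 χ sa) :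
    ∃ sD : HA L e dV hdV dW hdW →* MpD L e dV hdV dW hdW, IsDoubledWeilRep L e dV hdV hdV0 dW hdW hdW0 χ sD :=
  ⟨assemble L e dV hdV hdV0 dW hdW hdW0 hf ha,
    { continuous := S1asm_continuous L e dV hdV hdV0 dW hdW hdW0 hf ha
      proj_eq := proj_assemble L e dV hdV hdV0 dW hdW hdW0 hf ha
      parabolic := S1asm_parabolic L e dV hdV hdV0 dW hdW hdW0 hf ha }⟩

end Assembly

/-! ### Build-lane note (ops-buildfix G11b-3 recipe, LEDGER B13-1, 2026-08-21)
`lean -o` (the hub build lane, never `lean`/the gate check) runs Lean 4.32's library-suggestion indexers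
(`Lean.LibrarySuggestions.SymbolFrequency` / `SineQuaNon`, from their `exportEntriesFn`) over the statement of
every local theorem that is not a denied premise; on this family's statements (very large dependent binder
telescopes through the theta-kernel / dual-pair data) that fold runs for tens of minutes to hours and the build
lane kills the job (incident G11b-3, run/shared/lean/ops/buildfix/G11b-3-DOSSIER.md). `isDeniedPremise` skips
`[implicit_reducible]` constants before any fold, and a reducibility status on a *theorem* is inert (Meta never
unfolds `thmInfo`; the kernel ignores the attribute), so the public theorems of this file are tagged
`[implicit_reducible]` purely to keep them out of that index. Only other effect: they are not offered by
`+suggestions` premise selectors. No statement or proof is changed; superseded if the operator lands a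
deny-list form (`HarnessLib.PremiseIndex`). -/
set_option allowUnsafeReducibility true in
attribute [implicit_reducible]
  commute_abstract commute_halves proj_assemble S1asm_continuous S1par_components S1asm_parabolic
  isDoubledWeilRep_of_halves

end Literature.NumberTheory.GelbartRogawski1991.GRConstruction
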